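import Summits.CriticalPhenomena.Ising3DConformalLimit.Theses.EnergyNotSigmaSquared
import Summits.CriticalPhenomena.Ising3DConformalLimit.Theorems.GapForcesFarMerging.Negative.IsingCertificate
import Summits.CriticalPhenomena.Ising3DConformalLimit.Theorems.GapForcesFarMerging.Negative.LineShapes
import Summits.CriticalPhenomena.Ising3DConformalLimit.Theorems.GapForcesFarMerging.Negative.NotRP
import Literature.Probability.LatticeModels.CriticalTwoPointBounds

/-!
# Thin-shape scale iteration: single-pinch law ∧ positivity ∧ quasi-multiplicativity ⟹ far merging
# (line `rp-unpinch-single-passage` of crux `GapForcesFarMerging`, item stmt-CriticalPhenomena-4468; stub `stub_scaleIteration`)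

Stub 5 of the lead skeleton of the line `rp-unpinch-single-passage` (route `EnergyNotSigmaSquared`):

  `SinglePinchLaw → SinglePinchPositive → QuasiMultiplicative → FarMergingShape cc2 (criticalCorr 3 4)`,

written out over tree vocabulary (`criticalCorr 3 4`, `criticalCorr 3 2`, `criticalTwoPoint 3`,
`Pi.single`, and the landed `Negative.e₂ / Negative.cc2 / Negative.FarMergingShape`).

The statement is SOFT: it holds for every triple `(S, T, F)` (pair kernel, two-point function,
four-point function) satisfying the model-free package `Negative.SoftPackageNoBubble`
(`scaleIteration_soft` below), and the critical Ising correlators of `ℤ³` satisfy that package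
(`Negative.softPackageNoBubble_criticalCorr`, a theorem of the tree). The abstract shapes
`Negative.SinglePinchLawShape / SinglePinchPositiveShape / QuasiMultiplicativeShape` and the lattice
vocabulary `Negative.xR / up / dn / src / Th` are the landed ones of `Negative/LineShapes.lean`; at
`(cc2, criticalTwoPoint 3, criticalCorr 3 4)` they unfold definitionally to the registered text.

Mathematics (by contradiction). No far merging with `c = 1/2` along the thin injective shape
`Th(2^ℓ) = (0, (2^{ℓ+1},-2^ℓ,0), e₂, (2^{ℓ+1},2^ℓ,0))`, whose `2^i`-dilation is the opened-pinch
configuration `(0, dn 2^{i+ℓ}, 2^i e₂, up 2^{i+ℓ})`, gives `𝒜(2^i e₂; 2^{i+ℓ}) > 1/2` for all large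
`i` (Aizenman's `U₄ ≤ -c SS` read backwards); quasi-multiplicativity then gives
`𝒜(e₂; 2^{i+ℓ}) ≥ (c/2)·𝒜(e₂; 2^i)`, iterated from the minimum of `𝒜(e₂; 2^{L₀+j})`, `j < ℓ`
(strict positivity). On the other side the single-pinch law and the Messager–Miracle-Solé
monotonicity of the package bound `𝒜(e₂; 2^i) ≤ C⁺ 2^{-κ'(i+1)} b(i+1)²/b(i+3)²`,
`b(n) = S(0, 2^n e₁)`, and `b(i+1) ≤ 32·b(i+3)` for infinitely many `i` (else `b` would decay like
`32^{-i/2}` along the axis, faster than the lower bound `c‖x‖⁻²` allows). Choosing `ℓ` with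
`2^{-κ'ℓ} ≤ c/4` the two bounds are incompatible at a deep good scale.

-- adapted from Cruxes/GapForcesFarMerging/Disproof.lean §7 (refuter-cdisprove-stmt-CriticalPhenomena-4468-g2/g3),
-- `scaleIteration_soft` / `scaleIteration_criticalCorr`; the [folklore] docstrings are kept.

## References

* M. Aizenman, Comm. Math. Phys. 86 (1982) 1–48, §§4–5 [AizenmanCMP1982].
* M. Aizenman, H. Duminil-Copin, Ann. Math. 194 (2021), §5.1 eq. (5.3) [AizenmanDuminilCopinAnnals2021].
* A. Messager, S. Miracle-Solé, J. Stat. Phys. 17 (1977) 245–262 [MessagerMiracleSoleJSP1977].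
-/

noncomputable section

namespace Summit.CriticalPhenomena.Ising3DConformalLimit.EnergyNotSigmaSquaredGapForcesFarMerging

open Literature.Probability.LatticeModels
open Summit.CriticalPhenomena.Ising3DConformalLimit.Theses.EnergyNotSigmaSquared
open Summit.CriticalPhenomena.Ising3DConformalLimit.Theorems.GapForcesFarMerging.Negative (e₁ e₂ cc2 FarMergingShape)
open Summit.CriticalPhenomena.Ising3DConformalLimit.Theorems.GapForcesFarMerging.Negative
  (SoftPackageNoBubble softPackageNoBubble_criticalCorr xR up dn src Th pairCovS TS NparS avoidS
    SinglePinchLawShape SinglePinchPositiveShape QuasiMultiplicativeShape smul_Th smul_Th_pts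
    Th_injective norm_vec3)

namespace ScaleIteration

variable {S : Site 3 → Site 3 → ℝ} {T : Site 3 → ℝ} {F : (Fin 4 → Site 3) → ℝ}

/-! ### Lattice bookkeeping -/

/-- `up m` as an explicit triple. [folklore] -/
theorem up_eq (m : ℕ) : up m = ![2 * (m : ℤ), (m : ℤ), 0] := by
  ext i; fin_cases i <;> simp [up, xR]

/-- `dn m` as an explicit triple. [folklore] -/
theorem dn_eq (m : ℕ) : dn m = ![2 * (m : ℤ), -(m : ℤ), 0] := by
  ext i; fin_cases i <;> simp [dn, xR]

/-- `up m - e₂` as an explicit triple. [folklore] -/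
theorem up_sub_e₂ (m : ℕ) : up m - e₂ = ![2 * (m : ℤ), (m : ℤ) - 1, 0] := by
  ext i; fin_cases i <;> simp [up, xR]

/-- `‖dn m‖ = 2m`. [folklore] -/
theorem norm_dn (m : ℕ) : ‖dn m‖ = 2 * (m : ℝ) := by
  rw [dn_eq, norm_vec3]
  have h0 : (0 : ℝ) ≤ m := Nat.cast_nonneg m
  push_cast
  rw [abs_of_nonneg (by positivity), abs_neg, abs_of_nonneg h0, abs_zero]
  rw [max_eq_left h0, max_eq_left (by linarith)]

/-- `‖up m - e₂‖ = 2m` for `m ≥ 1`. [folklore] -/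
theorem norm_up_sub_e₂ {m : ℕ} (hm : 1 ≤ m) : ‖up m - e₂‖ = 2 * (m : ℝ) := by
  rw [up_sub_e₂, norm_vec3]
  have h1 : (1 : ℝ) ≤ m := by exact_mod_cast hm
  push_cast
  rw [abs_of_nonneg (by positivity), abs_of_nonneg (by linarith), abs_zero]
  rw [max_eq_left (by linarith : (0 : ℝ) ≤ (m : ℝ) - 1), max_eq_left (by linarith)]

/-- `‖k e₁‖ = k`. [folklore] -/
theorem norm_single0_nat (k : ℕ) : ‖(Pi.single 0 (k : ℤ) : Site 3)‖ = k := by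
  rw [Pi.norm_single]; simp

/-- `xR (2^i) = 2^{i+1} e₁`. [folklore] -/
theorem xR_two_pow (i : ℕ) : xR (2 ^ i) = Pi.single 0 ((2 ^ (i + 1) : ℕ) : ℤ) := by
  unfold xR; congr 1; push_cast; ring

/-- `((2:ℝ)^n)^{-κ} = (2^{-κ})^n`. [folklore] -/
theorem two_pow_rpow_neg (n : ℕ) (κ : ℝ) : ((2 : ℝ) ^ n) ^ (-κ) = ((2 : ℝ) ^ (-κ)) ^ n := by
  rw [← Real.rpow_natCast 2 n, ← Real.rpow_mul zero_le_two, mul_comm, Real.rpow_mul zero_le_two,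
    Real.rpow_natCast]

/-! ### The soft package at the opened-pinch configurations -/

/-- Relabelling `(0, d, s, u) ↦ (0, s, u, d)` under the permutation symmetry of `F`. [folklore] -/
theorem F_perm_dsu (hP : SoftPackageNoBubble S T F) (d s u : Site 3) :
    F ![0, s, u, d] = F ![0, d, s, u] := by
  have h1 : (![0, d, s, u] : Fin 4 → Site 3) ∘ ⇑(Equiv.swap (1 : Fin 4) 2) = ![0, s, d, u] := by
    funext i; fin_cases i <;> simp [Equiv.swap_apply_of_ne_of_ne]
  have h2 : (![0, s, d, u] : Fin 4 → Site 3) ∘ ⇑(Equiv.swap (2 : Fin 4) 3) = ![0, s, u, d] := by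
    funext i; fin_cases i <;> simp [Equiv.swap_apply_of_ne_of_ne]
  rw [← h2, hP.swap23, ← h1, hP.swap12]

/-- The parallel normalisation is positive. [folklore] -/
theorem NparS_pos (hP : SoftPackageNoBubble S T F) (b : Site 3) (m : ℕ) : 0 < NparS S b m :=
  mul_pos (hP.pos _ _) (hP.pos _ _)

/-- **No merging at the opened configuration forces `𝒜(src s; m) > 1/2`** (Aizenman's
`U₄ ≤ -c⟨σσ⟩⟨σσ⟩` read backwards with `c = 1/2`). [folklore] -/
theorem half_lt_avoidS_of_not_merge (hP : SoftPackageNoBubble S T F) {s m : ℕ}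
    (h : -(1 / 2 * (S 0 (dn m) * S (src s) (up m))) <
      F ![0, dn m, src s, up m] - (S 0 (dn m) * S (src s) (up m) + S 0 (src s) * S (dn m) (up m) +
        S 0 (up m) * S (dn m) (src s))) :
    1 / 2 < avoidS S F (src s) m := by
  unfold avoidS TS pairCovS NparS
  rw [lt_div_iff₀ (mul_pos (hP.pos _ _) (hP.pos _ _)), F_perm_dsu hP, hP.symm (up m) (dn m)]
  have h0 : 0 ≤ S 0 (up m) * S (dn m) (src s) := mul_nonneg (hP.pos _ _).le (hP.pos _ _).le
  linarith

/-- **Upper bound at a dyadic scale**: `𝒜(e₂; 2^i) ≤ C⁺ r^{i+1} b(i+1)² / b(i+3)²`, `r = 2^{-κ'}`,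
`b(n) = S(0, 2^n e₁)`, from the single-pinch law and MMS (`S(0,dn), S(e₂,up) ≥ S(0, 8m e₁)`). [folklore] -/
theorem avoidS_dyadic_le (hP : SoftPackageNoBubble S T F) {κ' C : ℝ}
    (hspl : ∀ m : ℕ, 1 ≤ m → pairCovS S F 0 e₂ (up m) (dn m) ≤ C * (2 * (m : ℝ)) ^ (-κ') * T (xR m) ^ 2)
    (i : ℕ) :
    avoidS S F e₂ (2 ^ i) ≤
      max C 0 * ((2 : ℝ) ^ (-κ')) ^ (i + 1) * S 0 (Pi.single 0 ((2 ^ (i + 1) : ℕ) : ℤ)) ^ 2 /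
        S 0 (Pi.single 0 ((2 ^ (i + 3) : ℕ) : ℤ)) ^ 2 := by
  have hm : 1 ≤ 2 ^ i := Nat.one_le_two_pow
  -- the numerator
  have hT : T (xR (2 ^ i)) = S 0 (Pi.single 0 ((2 ^ (i + 1) : ℕ) : ℤ)) := by rw [hP.two, xR_two_pow]
  have hr : (2 * ((2 ^ i : ℕ) : ℝ)) ^ (-κ') = ((2 : ℝ) ^ (-κ')) ^ (i + 1) := by
    rw [← two_pow_rpow_neg]; push_cast; ring_nf
  have hnum : TS S F e₂ (2 ^ i) ≤
      max C 0 * ((2 : ℝ) ^ (-κ')) ^ (i + 1) * S 0 (Pi.single 0 ((2 ^ (i + 1) : ℕ) : ℤ)) ^ 2 := by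
    have h := hspl (2 ^ i) hm
    rw [hT, hr] at h
    refine h.trans ?_
    have h0 : 0 ≤ ((2 : ℝ) ^ (-κ')) ^ (i + 1) * S 0 (Pi.single 0 ((2 ^ (i + 1) : ℕ) : ℤ)) ^ 2 := by
      positivity
    calc C * ((2 : ℝ) ^ (-κ')) ^ (i + 1) * S 0 (Pi.single 0 ((2 ^ (i + 1) : ℕ) : ℤ)) ^ 2
        = C * (((2 : ℝ) ^ (-κ')) ^ (i + 1) * S 0 (Pi.single 0 ((2 ^ (i + 1) : ℕ) : ℤ)) ^ 2) := by ring
      _ ≤ max C 0 * (((2 : ℝ) ^ (-κ')) ^ (i + 1) * S 0 (Pi.single 0 ((2 ^ (i + 1) : ℕ) : ℤ)) ^ 2) :=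
          mul_le_mul_of_nonneg_right (le_max_left _ _) h0
      _ = _ := by ring
  -- the denominator
  have h8 : (Pi.single 0 ((2 ^ (i + 3) : ℕ) : ℤ) : Site 3) = Pi.single 0 ((8 * 2 ^ i : ℕ) : ℤ) := by
    congr 2; ring
  have hnorm8 : ‖(Pi.single 0 ((8 * 2 ^ i : ℕ) : ℤ) : Site 3)‖ = 8 * ((2 ^ i : ℕ) : ℝ) := by
    rw [norm_single0_nat]; push_cast; ring
  have hdn : S 0 (Pi.single 0 ((2 ^ (i + 3) : ℕ) : ℤ)) ≤ S 0 (dn (2 ^ i)) := by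
    rw [h8]
    apply hP.mms
    rw [norm_dn, hnorm8]; linarith
  have hup : S 0 (Pi.single 0 ((2 ^ (i + 3) : ℕ) : ℤ)) ≤ S e₂ (up (2 ^ i)) := by
    have ht : S e₂ (up (2 ^ i)) = S 0 (up (2 ^ i) - e₂) := by
      have := hP.transl 0 (up (2 ^ i) - e₂) e₂
      rwa [zero_add, sub_add_cancel] at this
    rw [ht, h8]
    apply hP.mms
    rw [norm_up_sub_e₂ hm, hnorm8]; linarith
  have hb0 : 0 < S 0 (Pi.single 0 ((2 ^ (i + 3) : ℕ) : ℤ)) := hP.pos _ _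
  have hden : S 0 (Pi.single 0 ((2 ^ (i + 3) : ℕ) : ℤ)) ^ 2 ≤ NparS S e₂ (2 ^ i) := by
    rw [sq]; exact mul_le_mul hdn hup hb0.le (hP.pos _ _).le
  unfold avoidS
  calc TS S F e₂ (2 ^ i) / NparS S e₂ (2 ^ i)
      ≤ (max C 0 * ((2 : ℝ) ^ (-κ')) ^ (i + 1) * S 0 (Pi.single 0 ((2 ^ (i + 1) : ℕ) : ℤ)) ^ 2) /
          NparS S e₂ (2 ^ i) :=
        div_le_div_of_nonneg_right hnum (NparS_pos hP _ _).le
    _ ≤ (max C 0 * ((2 : ℝ) ^ (-κ')) ^ (i + 1) * S 0 (Pi.single 0 ((2 ^ (i + 1) : ℕ) : ℤ)) ^ 2) /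
          S 0 (Pi.single 0 ((2 ^ (i + 3) : ℕ) : ℤ)) ^ 2 :=
        div_le_div_of_nonneg_left (by positivity) (by positivity) hden

/-- **Infinitely many good dyadic scales**: `b(i+1) ≤ 32·b(i+3)` for infinitely many `i`,
`b(n) = S(0, 2^n e₁)` (else `b` decays like `32^{-i/2}` along the axis, faster than the lower bound
`c‖x‖⁻²` allows). [folklore] -/
theorem exists_good_scale (hP : SoftPackageNoBubble S T F) (N : ℕ) :
    ∃ i, N ≤ i ∧ S 0 (Pi.single 0 ((2 ^ (i + 1) : ℕ) : ℤ)) ≤ 32 * S 0 (Pi.single 0 ((2 ^ (i + 3) : ℕ) : ℤ)) := by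
  by_contra hne
  push Not at hne
  -- exponential decay along `N + 1 + 2j`
  have hdec : ∀ j : ℕ, (2 : ℝ) ^ (5 * j) * S 0 (Pi.single 0 ((2 ^ (N + 1 + 2 * j) : ℕ) : ℤ)) ≤
      S 0 (Pi.single 0 ((2 ^ (N + 1) : ℕ) : ℤ)) := by
    intro j
    induction j with
    | zero => simp
    | succ j ih =>
      have h := hne (N + 2 * j) (by omega)
      rw [show N + 2 * j + 1 = N + 1 + 2 * j by ring] at h
      rw [show N + 1 + 2 * (j + 1) = N + 2 * j + 3 by ring]
      have hpos : 0 ≤ (2 : ℝ) ^ (5 * j) := by positivity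
      calc (2 : ℝ) ^ (5 * (j + 1)) * S 0 (Pi.single 0 ((2 ^ (N + 2 * j + 3) : ℕ) : ℤ))
          = 2 ^ (5 * j) * (32 * S 0 (Pi.single 0 ((2 ^ (N + 2 * j + 3) : ℕ) : ℤ))) := by ring
        _ ≤ 2 ^ (5 * j) * S 0 (Pi.single 0 ((2 ^ (N + 1 + 2 * j) : ℕ) : ℤ)) :=
            mul_le_mul_of_nonneg_left h.le hpos
        _ ≤ S 0 (Pi.single 0 ((2 ^ (N + 1) : ℕ) : ℤ)) := ih
  -- lower bound `c₀ ≤ 2^{2n} b n`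
  obtain ⟨c₀, hc₀, hlow⟩ := hP.lower
  have hlow' : ∀ n : ℕ, c₀ ≤ (2 : ℝ) ^ (2 * n) * S 0 (Pi.single 0 ((2 ^ n : ℕ) : ℤ)) := by
    intro n
    have hx : (Pi.single 0 ((2 ^ n : ℕ) : ℤ) : Site 3) ≠ 0 := by
      intro h0
      have := congrFun h0 0
      simp at this
    have h := hlow _ hx
    rw [norm_single0_nat, Real.rpow_neg (by positivity), Real.rpow_two] at h
    push_cast at h
    rw [mul_inv_le_iff₀ (by positivity)] at h
    calc c₀ ≤ S 0 (Pi.single 0 ((2 ^ n : ℕ) : ℤ)) * ((2 : ℝ) ^ n) ^ 2 := h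
      _ = (2 : ℝ) ^ (2 * n) * S 0 (Pi.single 0 ((2 ^ n : ℕ) : ℤ)) := by ring
  have hb1 : S 0 (Pi.single 0 ((2 ^ (N + 1) : ℕ) : ℤ)) ≤ 1 := hP.le_one _ _
  -- `c₀ 2^j ≤ 2^{2N+2}` for every `j`
  have hbound : ∀ j : ℕ, c₀ * (2 : ℝ) ^ j ≤ (2 : ℝ) ^ (2 * N + 2) := by
    intro j
    have h1 := hlow' (N + 1 + 2 * j)
    have h2 := hdec j
    have hpos : 0 < (2 : ℝ) ^ (4 * j) := by positivity
    have hpos' : 0 ≤ (2 : ℝ) ^ (2 * (N + 1 + 2 * j)) := by positivity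
    have h3 : c₀ * (2 : ℝ) ^ (5 * j) ≤
        (2 : ℝ) ^ (2 * (N + 1 + 2 * j)) * S 0 (Pi.single 0 ((2 ^ (N + 1) : ℕ) : ℤ)) := by
      calc c₀ * (2 : ℝ) ^ (5 * j)
          ≤ (2 : ℝ) ^ (2 * (N + 1 + 2 * j)) * S 0 (Pi.single 0 ((2 ^ (N + 1 + 2 * j) : ℕ) : ℤ)) *
              2 ^ (5 * j) :=
            mul_le_mul_of_nonneg_right h1 (by positivity)
        _ = (2 : ℝ) ^ (2 * (N + 1 + 2 * j)) *
              (2 ^ (5 * j) * S 0 (Pi.single 0 ((2 ^ (N + 1 + 2 * j) : ℕ) : ℤ))) := by ring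
        _ ≤ (2 : ℝ) ^ (2 * (N + 1 + 2 * j)) * S 0 (Pi.single 0 ((2 ^ (N + 1) : ℕ) : ℤ)) :=
            mul_le_mul_of_nonneg_left h2 hpos'
    have h4 : c₀ * (2 : ℝ) ^ (5 * j) ≤ (2 : ℝ) ^ (2 * (N + 1 + 2 * j)) :=
      h3.trans (mul_le_of_le_one_right hpos' hb1)
    refine le_of_mul_le_mul_right ?_ hpos
    calc c₀ * (2 : ℝ) ^ j * 2 ^ (4 * j) = c₀ * (2 : ℝ) ^ (5 * j) := by ring
      _ ≤ (2 : ℝ) ^ (2 * (N + 1 + 2 * j)) := h4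
      _ = (2 : ℝ) ^ (2 * N + 2) * 2 ^ (4 * j) := by ring
  obtain ⟨j, hj⟩ := pow_unbounded_of_one_lt ((2 : ℝ) ^ (2 * N + 2) / c₀) one_lt_two
  rw [div_lt_iff₀ hc₀] at hj
  linarith [hbound j, mul_comm c₀ ((2 : ℝ) ^ j)]

/-- **Stub 5 is soft.** Over any triple with the soft package: single-pinch law + strict
single-pinch positivity + one-passage quasi-multiplicativity ⟹ far merging (along a thin shape
`Th(2^ℓ)`, by contradiction with `c = 1/2`). [folklore] -/
theorem scaleIteration_soft (hP : SoftPackageNoBubble S T F) :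
    SinglePinchLawShape S T F → SinglePinchPositiveShape S F → QuasiMultiplicativeShape S F →
      FarMergingShape S F := by
  rintro ⟨κ', C, hκ', hspl⟩ hSPP ⟨c, hc, hqm⟩
  by_contra hFM
  -- the avoidance sequence along dyadic scales and its positivity
  set A : ℕ → ℝ := fun i => avoidS S F e₂ (2 ^ i) with hA
  have hApos : ∀ i, 0 < A i := fun i =>
    div_pos (hSPP (2 ^ i) Nat.one_le_two_pow) (NparS_pos hP _ _)
  -- r = 2^{-κ'} ∈ (0,1); choose ℓ ≥ 1 with r^ℓ ≤ c/4
  set r : ℝ := (2 : ℝ) ^ (-κ') with hr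
  have hr0 : 0 < r := Real.rpow_pos_of_pos two_pos _
  have hr1 : r < 1 := Real.rpow_lt_one_of_one_lt_of_neg one_lt_two (by linarith)
  obtain ⟨ℓ₀, hℓ₀⟩ := exists_pow_lt_of_lt_one (show 0 < c / 4 by positivity) hr1
  obtain ⟨ℓ, hℓ1, hrℓ⟩ : ∃ ℓ : ℕ, 1 ≤ ℓ ∧ r ^ ℓ ≤ c / 4 :=
    ⟨ℓ₀ + 1, by omega, (pow_le_pow_of_le_one hr0.le hr1.le (Nat.le_succ ℓ₀)).trans hℓ₀.le⟩
  have h2ℓ : 2 ≤ 2 ^ ℓ :=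
    calc 2 = 2 ^ 1 := (pow_one 2).symm
      _ ≤ 2 ^ ℓ := Nat.pow_le_pow_right (by norm_num) hℓ1
  -- no far merging along the thin shape Th(2^ℓ) with c = 1/2
  have hFM' := hFM
  unfold FarMergingShape at hFM'
  push Not at hFM'
  obtain ⟨L₀, hL₀⟩ := hFM' (1 / 2) (by norm_num) (Th (2 ^ ℓ)) (Th_injective Nat.one_le_two_pow)
  -- one step of the iteration
  have step : ∀ i, L₀ ≤ i → c / 2 * A i ≤ A (i + ℓ) := by
    intro i hi
    have hL := hL₀ (2 ^ i) (hi.trans Nat.lt_two_pow_self.le)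
    obtain ⟨h0, h1, h2, h3⟩ := smul_Th_pts (2 ^ ℓ) (2 ^ i)
    rw [smul_Th, h0, h1, h2, h3] at hL
    have hav := half_lt_avoidS_of_not_merge hP hL
    rw [show 2 ^ ℓ * 2 ^ i = 2 ^ (i + ℓ) by rw [← pow_add, add_comm]] at hav
    have hq := hqm (2 ^ i) (2 ^ (i + ℓ)) Nat.one_le_two_pow
      (by rw [pow_add, mul_comm]; exact Nat.mul_le_mul_left _ h2ℓ)
    have hAi : 0 ≤ A i := (hApos i).le
    show c / 2 * A i ≤ A (i + ℓ)
    have : c / 2 * A i ≤ c * avoidS S F e₂ (2 ^ i) * avoidS S F (src (2 ^ i)) (2 ^ (i + ℓ)) := by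
      have := mul_nonneg hc.le hAi
      show c / 2 * A i ≤ c * A i * avoidS S F (src (2 ^ i)) (2 ^ (i + ℓ))
      nlinarith
    exact this.trans hq
  -- the iteration
  have iter : ∀ i, L₀ ≤ i → ∀ k : ℕ, (c / 2) ^ k * A i ≤ A (i + k * ℓ) := by
    intro i hi k
    induction k with
    | zero => simp
    | succ k ih =>
      have hs := step (i + k * ℓ) (by omega)
      rw [show i + (k + 1) * ℓ = i + k * ℓ + ℓ by ring]
      calc (c / 2) ^ (k + 1) * A i = (c / 2) * ((c / 2) ^ k * A i) := by ring
        _ ≤ (c / 2) * A (i + k * ℓ) := mul_le_mul_of_nonneg_left ih (by positivity)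
        _ ≤ A (i + k * ℓ + ℓ) := hs
  -- a uniform positive floor over the ℓ starting scales
  obtain ⟨j₀, hj₀, hmin⟩ := Finset.exists_min_image (Finset.range ℓ) (fun j => A (L₀ + j))
    ⟨0, Finset.mem_range.2 (by omega)⟩
  set a₀ := A (L₀ + j₀) with ha₀
  have ha₀pos : 0 < a₀ := hApos _
  have lower : ∀ i, L₀ ≤ i → (c / 2) ^ ((i - L₀) / ℓ) * a₀ ≤ A i := by
    intro i hi
    have hdecomp : i = L₀ + (i - L₀) % ℓ + (i - L₀) / ℓ * ℓ := by
      have := Nat.mod_add_div (i - L₀) ℓ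
      rw [mul_comm] ; omega
    have hjlt : (i - L₀) % ℓ < ℓ := Nat.mod_lt _ (by omega)
    have h1 := iter (L₀ + (i - L₀) % ℓ) (by omega) ((i - L₀) / ℓ)
    rw [← hdecomp] at h1
    have h2 : a₀ ≤ A (L₀ + (i - L₀) % ℓ) := hmin _ (Finset.mem_range.2 hjlt)
    calc (c / 2) ^ ((i - L₀) / ℓ) * a₀ ≤ (c / 2) ^ ((i - L₀) / ℓ) * A (L₀ + (i - L₀) % ℓ) :=
          mul_le_mul_of_nonneg_left h2 (by positivity)
      _ ≤ A i := h1
  -- choose the depth k₀ and a good scale beyond it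
  set Cp : ℝ := max C 0 with hCp
  have hCp0 : 0 ≤ Cp := le_max_right _ _
  obtain ⟨k₀, hk₀⟩ := exists_pow_lt_of_lt_one (show 0 < a₀ / (1024 * Cp + 1) by positivity)
    (show (1 / 2 : ℝ) < 1 by norm_num)
  obtain ⟨i, hiN, hgood⟩ := exists_good_scale hP (L₀ + k₀ * ℓ)
  have hiL : L₀ ≤ i := by omega
  set k : ℕ := (i - L₀) / ℓ with hk
  have hk₀k : k₀ ≤ k := (Nat.le_div_iff_mul_le (by omega)).2 (by omega)
  have hkℓ : k * ℓ ≤ i + 1 := (Nat.div_mul_le_self (i - L₀) ℓ).trans (by omega)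
  -- upper bound at the good scale
  have hup : A i ≤ 1024 * Cp * r ^ (i + 1) := by
    have h := avoidS_dyadic_le hP hspl i
    have hb3 : 0 < S 0 (Pi.single 0 ((2 ^ (i + 3) : ℕ) : ℤ)) := hP.pos _ _
    have hb1 : 0 ≤ S 0 (Pi.single 0 ((2 ^ (i + 1) : ℕ) : ℤ)) := (hP.pos _ _).le
    have hratio : S 0 (Pi.single 0 ((2 ^ (i + 1) : ℕ) : ℤ)) ^ 2 /
        S 0 (Pi.single 0 ((2 ^ (i + 3) : ℕ) : ℤ)) ^ 2 ≤ 1024 := by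
      rw [div_le_iff₀ (by positivity)]
      nlinarith [mul_le_mul hgood hgood hb1 (by positivity)]
    calc A i ≤ Cp * r ^ (i + 1) * S 0 (Pi.single 0 ((2 ^ (i + 1) : ℕ) : ℤ)) ^ 2 /
          S 0 (Pi.single 0 ((2 ^ (i + 3) : ℕ) : ℤ)) ^ 2 := h
      _ = Cp * r ^ (i + 1) * (S 0 (Pi.single 0 ((2 ^ (i + 1) : ℕ) : ℤ)) ^ 2 /
          S 0 (Pi.single 0 ((2 ^ (i + 3) : ℕ) : ℤ)) ^ 2) := by ring
      _ ≤ Cp * r ^ (i + 1) * 1024 := mul_le_mul_of_nonneg_left hratio (by positivity)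
      _ = 1024 * Cp * r ^ (i + 1) := by ring
  -- r^{i+1} ≤ (r^ℓ)^k ≤ (c/4)^k = (c/2)^k (1/2)^k
  have hrk : r ^ (i + 1) ≤ (c / 2) ^ k * (1 / 2) ^ k := by
    calc r ^ (i + 1) ≤ r ^ (k * ℓ) := pow_le_pow_of_le_one hr0.le hr1.le hkℓ
      _ = (r ^ ℓ) ^ k := by rw [mul_comm, pow_mul]
      _ ≤ (c / 4) ^ k := pow_le_pow_left₀ (by positivity) hrℓ k
      _ = (c / 2) ^ k * (1 / 2) ^ k := by rw [← mul_pow]; ring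
  -- combine: (c/2)^k a₀ ≤ A i ≤ 1024 Cp (c/2)^k (1/2)^k, so a₀ ≤ 1024 Cp (1/2)^k ≤ 1024 Cp (1/2)^k₀ < a₀
  have hck : 0 < (c / 2) ^ k := by positivity
  have hmain : (c / 2) ^ k * a₀ ≤ (c / 2) ^ k * (1024 * Cp * (1 / 2) ^ k) := by
    calc (c / 2) ^ k * a₀ ≤ A i := lower i hiL
      _ ≤ 1024 * Cp * r ^ (i + 1) := hup
      _ ≤ 1024 * Cp * ((c / 2) ^ k * (1 / 2) ^ k) := mul_le_mul_of_nonneg_left hrk (by positivity)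
      _ = (c / 2) ^ k * (1024 * Cp * (1 / 2) ^ k) := by ring
  have h1 : a₀ ≤ 1024 * Cp * (1 / 2) ^ k := le_of_mul_le_mul_left hmain hck
  have h2 : (1 / 2 : ℝ) ^ k ≤ (1 / 2) ^ k₀ := pow_le_pow_of_le_one (by norm_num) (by norm_num) hk₀k
  have h3 : (1 / 2 : ℝ) ^ k₀ * (1024 * Cp + 1) < a₀ := by
    rwa [lt_div_iff₀ (by positivity)] at hk₀
  nlinarith [mul_le_mul_of_nonneg_left h2 (by positivity : (0 : ℝ) ≤ 1024 * Cp),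
    pow_pos (show (0 : ℝ) < 1 / 2 by norm_num) k₀]

end ScaleIteration

/-- **Stub 5 (M, soft) — thin-shape scale iteration.** Single-pinch law (exponent `κ' > 0`) ∧
strict single-pinch positivity ∧ one-passage quasi-multiplicativity ⟹ far merging (along
`Th(2^ℓ)`, by contradiction with `c = 1/2`, with abundance of doubling scales from
`c‖x‖⁻² ≤ ⟨σ₀σ_x⟩ ≤ 1`): the soft iteration `ScaleIteration.scaleIteration_soft` at the Ising
certificate `softPackageNoBubble_criticalCorr` (the abstract shapes unfold definitionally to the
registered text). [folklore] -/
theorem stub_scaleIteration :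
    (∃ κ' C : ℝ, 0 < κ' ∧ ∀ m : ℕ, 1 ≤ m →
        criticalCorr 3 4 ![0, e₂, Pi.single 0 (2 * (m : ℤ)) + Pi.single 1 (m : ℤ), Pi.single 0 (2 * (m : ℤ)) - Pi.single 1 (m : ℤ)] - criticalCorr 3 2 ![0, e₂] * criticalCorr 3 2 ![Pi.single 0 (2 * (m : ℤ)) + Pi.single 1 (m : ℤ), Pi.single 0 (2 * (m : ℤ)) - Pi.single 1 (m : ℤ)] ≤
          C * (2 * (m : ℝ)) ^ (-κ') * criticalTwoPoint 3 (Pi.single 0 (2 * (m : ℤ))) ^ 2) →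
      (∀ m : ℕ, 1 ≤ m →
        0 < criticalCorr 3 4 ![0, e₂, Pi.single 0 (2 * (m : ℤ)) + Pi.single 1 (m : ℤ), Pi.single 0 (2 * (m : ℤ)) - Pi.single 1 (m : ℤ)] - criticalCorr 3 2 ![0, e₂] * criticalCorr 3 2 ![Pi.single 0 (2 * (m : ℤ)) + Pi.single 1 (m : ℤ), Pi.single 0 (2 * (m : ℤ)) - Pi.single 1 (m : ℤ)]) →
      (∃ c : ℝ, 0 < c ∧ ∀ s m : ℕ, 1 ≤ s → 2 * s ≤ m →
        c * ((criticalCorr 3 4 ![0, e₂, Pi.single 0 (2 * (s : ℤ)) + Pi.single 1 (s : ℤ), Pi.single 0 (2 * (s : ℤ)) - Pi.single 1 (s : ℤ)] - criticalCorr 3 2 ![0, e₂] * criticalCorr 3 2 ![Pi.single 0 (2 * (s : ℤ)) + Pi.single 1 (s : ℤ), Pi.single 0 (2 * (s : ℤ)) - Pi.single 1 (s : ℤ)]) / (criticalCorr 3 2 ![0, Pi.single 0 (2 * (s : ℤ)) - Pi.single 1 (s : ℤ)] * criticalCorr 3 2 ![e₂, Pi.single 0 (2 * (s : ℤ)) +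 Pi.single 1 (s : ℤ)])) *
            ((criticalCorr 3 4 ![0, Pi.single 1 (s : ℤ), Pi.single 0 (2 * (m : ℤ)) + Pi.single 1 (m : ℤ), Pi.single 0 (2 * (m : ℤ)) - Pi.single 1 (m : ℤ)] - criticalCorr 3 2 ![0, Pi.single 1 (s : ℤ)] * criticalCorr 3 2 ![Pi.single 0 (2 * (m : ℤ)) + Pi.single 1 (m : ℤ), Pi.single 0 (2 * (m : ℤ)) - Pi.single 1 (m : ℤ)]) / (criticalCorr 3 2 ![0, Pi.single 0 (2 * (m : ℤ)) - Pi.single 1 (m : ℤ)] * criticalCorr 3 2 ![Pi.single 1 (s : ℤ), Pi.single 0 (2 * (m : ℤ)) + Pi.single 1 (m : ℤ)])) ≤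
          (criticalCorr 3 4 ![0, e₂, Pi.single 0 (2 * (m : ℤ)) + Pi.single 1 (m : ℤ), Pi.single 0 (2 * (m : ℤ)) - Pi.single 1 (m : ℤ)] - criticalCorr 3 2 ![0, e₂] * criticalCorr 3 2 ![Pi.single 0 (2 * (m : ℤ)) + Pi.single 1 (m : ℤ), Pi.single 0 (2 * (m : ℤ)) - Pi.single 1 (m : ℤ)]) / (criticalCorr 3 2 ![0, Pi.single 0 (2 * (m : ℤ)) - Pi.single 1 (m : ℤ)] * criticalCorr 3 2 ![e₂, Pi.single 0 (2 * (m : ℤ)) + Pi.single 1 (m : ℤ)])) →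
      FarMergingShape cc2 (criticalCorr 3 4) :=
  ScaleIteration.scaleIteration_soft softPackageNoBubble_criticalCorr

end Summit.CriticalPhenomena.Ising3DConformalLimit.EnergyNotSigmaSquaredGapForcesFarMerging

end
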